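import Literature.Analysis.FunctionSpaces.EquicontinuousExtraction
import Literature.Analysis.FunctionSpaces.ContDiffOnLimit
import Literature.Analysis.FunctionSpaces.DiagonalSubsequence
import Literature.Analysis.Calculus.IteratedFDerivEquicontinuity
import Mathlib.Analysis.SpecialFunctions.Pow.Real
import HarnessLib

/-!
# The `Cᵏ` Arzelà–Ascoli theorem on an open set

Analysis/FunctionSpaces support file (everything proved). The classical compactness principle
behind every "bounded in `C^{k,α}` ⇒ convergent in `Cᵏ`" step of elliptic theory
(Gilbarg–Trudinger 2001, §6.8, Lemmas 6.33 and 6.36 — bounded sets of `C^{k,α}` are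
precompact in `C^{j,β}`, `j + β < k + α`; Adams, *Sobolev spaces*, Thm. 1.34): let `f_j` be
`Cᵏ` on an open set `U` of a finite-dimensional real
normed space, with values in a finite-dimensional space, such that for every order `i ≤ k` the
family of derivatives `(Dⁱ f_j)_j` is pointwise bounded and equicontinuous on `U`. Then a
subsequence converges, together with all derivatives of order `≤ k`, locally uniformly on `U`
to a `Cᵏ` function `g` and its derivatives
(`exists_strictMono_tendstoLocallyUniformlyOn_iteratedFDeriv`). The working form
`exists_strictMono_tendstoLocallyUniformlyOn_iteratedFDeriv_of_bound` takes uniform bounds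
`‖Dⁱ f_j‖ ≤ B` (`i ≤ k`) on `U` — which make the derivatives of order `< k` equi-Lipschitz —
plus equicontinuity of the top order `Dᵏ f_j`, e.g. from a uniform Hölder modulus
(`equicontinuousOn_of_holder_modulus`); this is exactly how uniform `C^{k,α}` bounds are
consumed.

Assembly of tree results: the sequential Arzelà–Ascoli extraction on open sets
(`EquicontinuousExtraction`), Cantor's diagonal procedure (`DiagonalSubsequence`), the
`Cⁿ` limit theorem (`ContDiffOnLimit`), and equicontinuity of derivatives from bounds on the
next one (`Calculus/IteratedFDerivEquicontinuity`). The only new ingredient is the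
finite-dimensionality of the spaces of continuous multilinear maps in which the derivatives
take values (`finiteDimensional_continuousMultilinearMap_fin`).

## References

* D. Gilbarg, N. S. Trudinger, *Elliptic Partial Differential Equations of Second Order*,
  Springer Classics in Mathematics (2001), §6.8, Lemma 6.33 (PDF p. 218) and Lemma 6.36
  (PDF p. 221). [GilbargTrudinger2001]
* R. A. Adams, *Sobolev Spaces* (1975), Thm. 1.34 (Ascoli–Arzelà) and §1.29.
* J. B. Conway, *Functions of One Complex Variable* (1978), Ch. VII Thm. 1.23. [Conway1978]
-/

noncomputable section

open Set Metric Filter Topology Function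
open scoped ContDiff

namespace Literature.Analysis.FunctionSpaces

section General

variable {E : Type*} [NormedAddCommGroup E] [NormedSpace ℝ E]
  {F : Type*} [NormedAddCommGroup F] [NormedSpace ℝ F]

/-- The spaces `E [×i]→L[ℝ] F` of continuous multilinear maps between finite-dimensional spaces
are finite-dimensional (induction through the currying isomorphisms). [folklore] -/
theorem finiteDimensional_continuousMultilinearMap_fin [FiniteDimensional ℝ E]
    [FiniteDimensional ℝ F] : ∀ i : ℕ, FiniteDimensional ℝ (E [×i]→L[ℝ] F)
  | 0 => LinearEquiv.finiteDimensional (continuousMultilinearCurryFin0 ℝ E F).toLinearEquiv.symm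
  | (i + 1) => by
      haveI := finiteDimensional_continuousMultilinearMap_fin i
      exact LinearEquiv.finiteDimensional
        (continuousMultilinearCurryLeftEquiv ℝ (fun _ : Fin (i + 1) => E) F).toLinearEquiv.symm

/-- Locally uniform convergence along a sequence passes to eventual further subsequences.
[folklore] -/
theorem tendstoLocallyUniformlyOn_of_eventually_eq_comp {X : Type*} [TopologicalSpace X]
    {β : Type*} [UniformSpace β] {G : ℕ → X → β} {g : X → β} {s : Set X} {φ φ' ρ : ℕ → ℕ}
    (hρ : StrictMono ρ) (heq : ∀ᶠ k in atTop, φ' k = φ (ρ k))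
    (h : TendstoLocallyUniformlyOn (fun k => G (φ k)) g atTop s) :
    TendstoLocallyUniformlyOn (fun k => G (φ' k)) g atTop s := by
  intro u hu x hx
  obtain ⟨t, ht, hev⟩ := h u hu x hx
  refine ⟨t, ht, ?_⟩
  filter_upwards [hρ.tendsto_atTop.eventually hev, heq] with k hk hk'
  intro y hy
  rw [hk']
  exact hk y hy

/-- A uniform Hölder-type modulus `dist (G j x) (G j y) ≤ K * dist x y ^ α` (`0 < α`) on a set
makes the family equicontinuous on the set. [folklore] -/
theorem equicontinuousOn_of_holder_modulus {X : Type*} [PseudoMetricSpace X] {β : Type*}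
    [PseudoMetricSpace β] {ι : Type*} {G : ι → X → β} {s : Set X} {K α : ℝ} (hα : 0 < α)
    (hG : ∀ j, ∀ x ∈ s, ∀ y ∈ s, dist (G j x) (G j y) ≤ K * dist x y ^ α) :
    EquicontinuousOn G s := by
  intro x hx u hu
  obtain ⟨ε, hε, hεu⟩ := Metric.mem_uniformity_dist.1 hu
  have hK1 : 0 < |K| + 1 := by positivity
  have hεK : 0 < ε / (|K| + 1) := div_pos hε hK1
  set δ : ℝ := (ε / (|K| + 1)) ^ α⁻¹ with hδ
  have hδpos : 0 < δ := Real.rpow_pos_of_pos hεK _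
  have hmem : ∀ᶠ y in 𝓝[s] x, y ∈ ball x δ ∩ s :=
    inter_mem (mem_nhdsWithin_of_mem_nhds (ball_mem_nhds x hδpos)) self_mem_nhdsWithin
  filter_upwards [hmem] with y hy j
  apply hεu
  have hyx : dist x y < δ := by
    rw [dist_comm]
    exact hy.1
  have h1 : dist x y ^ α < ε / (|K| + 1) := by
    calc dist x y ^ α < δ ^ α := Real.rpow_lt_rpow dist_nonneg hyx hα
      _ = ε / (|K| + 1) := by rw [hδ, Real.rpow_inv_rpow hεK.le hα.ne']
  calc dist (G j x) (G j y) ≤ K * dist x y ^ α := hG j x hx y hy.2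
    _ ≤ (|K| + 1) * dist x y ^ α :=
        mul_le_mul_of_nonneg_right ((le_abs_self K).trans (le_add_of_nonneg_right zero_le_one))
          (Real.rpow_nonneg dist_nonneg _)
    _ < (|K| + 1) * (ε / (|K| + 1)) := mul_lt_mul_of_pos_left h1 hK1
    _ = ε := by field_simp

/-- Convergence of the order-one iterated derivatives at a point gives convergence of the
Fréchet derivatives there (the currying isometry `E [×1]→L F ≃ E →L F`). [folklore] -/
theorem tendsto_fderiv_of_tendsto_iteratedFDeriv_one {w : ℕ → E → F} {w₀ : E → F} {x : E}
    (h : Tendsto (fun j => iteratedFDeriv ℝ 1 (w j) x) atTop (𝓝 (iteratedFDeriv ℝ 1 w₀ x))) :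
    Tendsto (fun j => fderiv ℝ (w j) x) atTop (𝓝 (fderiv ℝ w₀ x)) := by
  have h1 := ((continuousMultilinearCurryFin1 ℝ E F).continuous.tendsto _).comp h
  have hcurry : ∀ u : E → F,
      continuousMultilinearCurryFin1 ℝ E F (iteratedFDeriv ℝ 1 u x) = fderiv ℝ u x := fun u => by
    ext v
    rw [continuousMultilinearCurryFin1_apply, iteratedFDeriv_one_apply]
    rfl
  simpa only [Function.comp_def, hcurry] using h1

/-- Convergence of the order-two iterated derivatives at a point gives convergence of the
order-one iterated derivatives of the Fréchet derivatives there (the currying isometry of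
`iteratedFDeriv_succ_eq_comp_right`). [folklore] -/
theorem tendsto_iteratedFDeriv_one_fderiv_of_two {w : ℕ → E → F} {w₀ : E → F} {x : E}
    (h : Tendsto (fun j => iteratedFDeriv ℝ 2 (w j) x) atTop (𝓝 (iteratedFDeriv ℝ 2 w₀ x))) :
    Tendsto (fun j => iteratedFDeriv ℝ 1 (fderiv ℝ (w j)) x) atTop
      (𝓝 (iteratedFDeriv ℝ 1 (fderiv ℝ w₀) x)) := by
  have hR : ∀ u : E → F, iteratedFDeriv ℝ 1 (fderiv ℝ u) x =
      continuousMultilinearCurryRightEquiv' ℝ 1 E F (iteratedFDeriv ℝ 2 u x) := fun u => by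
    rw [iteratedFDeriv_succ_eq_comp_right (n := 1), Function.comp_apply,
      LinearIsometryEquiv.apply_symm_apply]
  simp only [hR]
  exact ((continuousMultilinearCurryRightEquiv' ℝ 1 E F).continuous.tendsto _).comp h

end General

/-! ### The extraction -/

section Extraction

variable {E : Type*} [NormedAddCommGroup E] [NormedSpace ℝ E] [FiniteDimensional ℝ E]
  {F : Type*} [NormedAddCommGroup F] [NormedSpace ℝ F] [FiniteDimensional ℝ F]
  {U : Set E} {f : ℕ → E → F}

/-- **One subsequence for a set of orders.** If for every order `i ∈ S` the derivatives
`(Dⁱ f_j)_j` are pointwise bounded and equicontinuous on the open set `U`, then along one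
subsequence every `Dⁱ f_j`, `i ∈ S`, converges locally uniformly on `U` (Arzelà–Ascoli order by
order, then Cantor's diagonal procedure). [cite: Conway1978, Ch. VII Thm. 1.23] -/
theorem exists_strictMono_forall_tendstoLocallyUniformlyOn_iteratedFDeriv (hU : IsOpen U)
    (S : Set ℕ) (hb : ∀ i ∈ S, ∀ x ∈ U, ∃ M : ℝ, ∀ j, ‖iteratedFDeriv ℝ i (f j) x‖ ≤ M)
    (heq : ∀ i ∈ S, EquicontinuousOn (fun j => iteratedFDeriv ℝ i (f j)) U) :
    ∃ φ : ℕ → ℕ, StrictMono φ ∧ ∀ i ∈ S, ∃ G : E → E [×i]→L[ℝ] F,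
      TendstoLocallyUniformlyOn (fun j => iteratedFDeriv ℝ i (f (φ j))) G atTop U := by
  classical
  let P : S → (ℕ → ℕ) → Prop := fun i φ =>
    ∃ G : E → E [×(i : ℕ)]→L[ℝ] F,
      TendstoLocallyUniformlyOn (fun j => iteratedFDeriv ℝ i (f (φ j))) G atTop U
  have hsub : ∀ i (φ φ' : ℕ → ℕ), (∃ ρ : ℕ → ℕ, StrictMono ρ ∧ ∀ᶠ n in atTop, φ' n = φ (ρ n)) →
      P i φ → P i φ' := by
    rintro i φ φ' ⟨ρ, hρ, hρeq⟩ ⟨G, hG⟩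
    exact ⟨G, tendstoLocallyUniformlyOn_of_eventually_eq_comp
      (G := fun j => iteratedFDeriv ℝ (i : ℕ) (f j)) hρ hρeq hG⟩
  have hex : ∀ i (φ : ℕ → ℕ), StrictMono φ → ∃ ψ : ℕ → ℕ, StrictMono ψ ∧ P i (φ ∘ ψ) := by
    intro i φ _
    haveI := finiteDimensional_continuousMultilinearMap_fin (E := E) (F := F) (i : ℕ)
    obtain ⟨G, ψ, hψ, -, hG⟩ := exists_strictMono_tendstoLocallyUniformlyOn_of_equicontinuousOn hU
      (G := fun j => iteratedFDeriv ℝ (i : ℕ) (f (φ j))) ((heq i i.2).comp φ) (fun x hx => by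
        obtain ⟨M, hM⟩ := hb i i.2 x hx
        exact ⟨0, M, fun j => by simpa only [dist_zero_right] using hM (φ j)⟩)
    exact ⟨ψ, hψ, G, hG⟩
  obtain ⟨φ, hφ, hP⟩ := exists_strictMono_forall_of_extraction' hsub hex
  exact ⟨φ, hφ, fun i hi => hP ⟨i, hi⟩⟩

omit [FiniteDimensional ℝ F] in
/-- From locally uniform convergence on an open subset of a finite-dimensional space to the
"uniformly Cauchy near every point" hypothesis of the `Cⁿ` limit theorems. [folklore] -/
theorem forall_exists_uniformCauchySeqOn_of_tendstoLocallyUniformlyOn (hU : IsOpen U) {i : ℕ}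
    {φ : ℕ → ℕ} {G : E → E [×i]→L[ℝ] F}
    (hG : TendstoLocallyUniformlyOn (fun j => iteratedFDeriv ℝ i (f (φ j))) G atTop U) :
    ∀ x ∈ U, ∃ V ∈ 𝓝 x, UniformCauchySeqOn (fun j => iteratedFDeriv ℝ i (f (φ j))) atTop V := by
  intro x hx
  obtain ⟨r, hr, hrU⟩ := Metric.isOpen_iff.1 hU x hx
  have hK : closedBall x (r / 2) ⊆ U := (closedBall_subset_ball (half_lt_self hr)).trans hrU
  have hunif : TendstoUniformlyOn (fun j => iteratedFDeriv ℝ i (f (φ j))) G atTop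
      (closedBall x (r / 2)) :=
    (tendstoLocallyUniformlyOn_iff_forall_isCompact hU).1 hG _ hK (isCompact_closedBall _ _)
  exact ⟨closedBall x (r / 2), closedBall_mem_nhds x (half_pos hr), hunif.uniformCauchySeqOn⟩

omit [FiniteDimensional ℝ E] [FiniteDimensional ℝ F] in
/-- The pointwise limit read off from the convergence of the order-zero derivatives.
[folklore] -/
theorem tendsto_of_tendstoLocallyUniformlyOn_iteratedFDeriv_zero {φ : ℕ → ℕ}
    {G₀ : E → E [×0]→L[ℝ] F}
    (hG₀ : TendstoLocallyUniformlyOn (fun j => iteratedFDeriv ℝ 0 (f (φ j))) G₀ atTop U) {x : E}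
    (hx : x ∈ U) : Tendsto (fun j => f (φ j) x) atTop (𝓝 (G₀ x 0)) := by
  have h1 : Tendsto (fun j => iteratedFDeriv ℝ 0 (f (φ j)) x) atTop (𝓝 (G₀ x)) :=
    hG₀.tendsto_at hx
  have h2 : Tendsto (fun j => iteratedFDeriv ℝ 0 (f (φ j)) x 0) atTop (𝓝 (G₀ x 0)) :=
    ((continuous_eval_const (0 : Fin 0 → E)).tendsto _).comp h1
  simpa only [Function.comp_def, iteratedFDeriv_zero_apply] using h2

/-- **`Cᵏ` Arzelà–Ascoli on an open set (equicontinuous form).** If the `f_j` are `Cᵏ` on the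
open set `U` and, for each `i ≤ k`, the derivatives `(Dⁱ f_j)_j` are pointwise bounded and
equicontinuous on `U`, then along a subsequence `φ` all derivatives of order `≤ k` converge
locally uniformly on `U` to those of a `Cᵏ` function `g`.
[cite: GilbargTrudinger2001, §6.8, Lemma 6.33] -/
theorem exists_strictMono_tendstoLocallyUniformlyOn_iteratedFDeriv (hU : IsOpen U) {k : ℕ}
    (hf : ∀ j, ContDiffOn ℝ k (f j) U)
    (hb : ∀ i ≤ k, ∀ x ∈ U, ∃ M : ℝ, ∀ j, ‖iteratedFDeriv ℝ i (f j) x‖ ≤ M)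
    (heq : ∀ i ≤ k, EquicontinuousOn (fun j => iteratedFDeriv ℝ i (f j)) U) :
    ∃ (g : E → F) (φ : ℕ → ℕ), StrictMono φ ∧ ContDiffOn ℝ k g U ∧
      ∀ i ≤ k, TendstoLocallyUniformlyOn (fun j => iteratedFDeriv ℝ i (f (φ j)))
        (iteratedFDeriv ℝ i g) atTop U := by
  obtain ⟨φ, hφ, hP⟩ := exists_strictMono_forall_tendstoLocallyUniformlyOn_iteratedFDeriv hU
    {i | i ≤ k} hb heq
  obtain ⟨G₀, hG₀⟩ := hP 0 (Nat.zero_le k)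
  have hfg : ∀ x ∈ U, Tendsto (fun j => f (φ j) x) atTop (𝓝 (G₀ x 0)) := fun x hx =>
    tendsto_of_tendstoLocallyUniformlyOn_iteratedFDeriv_zero hG₀ hx
  have hC : ∀ i ≤ k, ∀ x ∈ U, ∃ V ∈ 𝓝 x,
      UniformCauchySeqOn (fun j => iteratedFDeriv ℝ i (f (φ j))) atTop V := by
    intro i hi
    obtain ⟨G, hG⟩ := hP i hi
    exact forall_exists_uniformCauchySeqOn_of_tendstoLocallyUniformlyOn hU hG
  have hf' : ∀ j, ContDiffOn ℝ k (f (φ j)) U := fun j => hf (φ j)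
  exact ⟨fun x => G₀ x 0, φ, hφ, contDiffOn_of_uniformCauchySeqOn_iteratedFDeriv hU hf' hfg hC,
    fun i hi => (tendstoLocallyUniformlyOn_iteratedFDeriv_of_uniformCauchySeqOn hU hf' hfg hC hi).1⟩

/-- **`Cᵏ` Arzelà–Ascoli on an open set (bounds form).** If the `f_j` are `Cᵏ` on the open set
`U` with uniform bounds `‖Dⁱ f_j‖ ≤ B` on `U` for all `i ≤ k`, and the top-order derivatives
`(Dᵏ f_j)_j` are equicontinuous on `U` (e.g. by a uniform Hölder modulus,
`equicontinuousOn_of_holder_modulus` — this is how uniform `C^{k,α}` bounds are consumed), then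
along a subsequence all derivatives of order `≤ k` converge locally uniformly on `U` to those of
a `Cᵏ` function. (The derivatives of order `< k` are equi-Lipschitz near each point by the mean
value inequality.) [cite: GilbargTrudinger2001, §6.8, Lemma 6.33] -/
theorem exists_strictMono_tendstoLocallyUniformlyOn_iteratedFDeriv_of_bound (hU : IsOpen U)
    {k : ℕ} (hf : ∀ j, ContDiffOn ℝ k (f j) U) {B : ℝ}
    (hB : ∀ j, ∀ i ≤ k, ∀ x ∈ U, ‖iteratedFDeriv ℝ i (f j) x‖ ≤ B)
    (htop : EquicontinuousOn (fun j => iteratedFDeriv ℝ k (f j)) U) :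
    ∃ (g : E → F) (φ : ℕ → ℕ), StrictMono φ ∧ ContDiffOn ℝ k g U ∧
      ∀ i ≤ k, TendstoLocallyUniformlyOn (fun j => iteratedFDeriv ℝ i (f (φ j)))
        (iteratedFDeriv ℝ i g) atTop U := by
  refine exists_strictMono_tendstoLocallyUniformlyOn_iteratedFDeriv hU hf
    (fun i hi x hx => ⟨B, fun j => hB j i hi x hx⟩) fun i hi => ?_
  rcases hi.lt_or_eq with hlt | rfl
  · exact Literature.Analysis.Calculus.equicontinuousOn_iteratedFDeriv_of_bound hU hf
      (by exact_mod_cast Nat.succ_le_of_lt hlt) fun j z hz => hB j (i + 1) hlt z hz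
  · exact htop

/-- **`C^∞` Arzelà–Ascoli on an open set.** If the `f_j` are `C^∞` on the open set `U` with,
for every order `i`, a uniform bound `‖Dⁱ f_j‖ ≤ B_i` on `U`, then along a subsequence all
derivatives converge locally uniformly on `U` to those of a `C^∞` function (every order is
equi-Lipschitz near each point by the bound on the next one; diagonal extraction over all
orders). [cite: GilbargTrudinger2001, §6.8, Lemma 6.33] -/
theorem exists_strictMono_tendstoLocallyUniformlyOn_iteratedFDeriv_infty (hU : IsOpen U)
    (hf : ∀ j, ContDiffOn ℝ ∞ (f j) U)
    (hB : ∀ i : ℕ, ∃ B : ℝ, ∀ j, ∀ x ∈ U, ‖iteratedFDeriv ℝ i (f j) x‖ ≤ B) :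
    ∃ (g : E → F) (φ : ℕ → ℕ), StrictMono φ ∧ ContDiffOn ℝ ∞ g U ∧
      ∀ i : ℕ, TendstoLocallyUniformlyOn (fun j => iteratedFDeriv ℝ i (f (φ j)))
        (iteratedFDeriv ℝ i g) atTop U := by
  have heq : ∀ i ∈ (univ : Set ℕ), EquicontinuousOn (fun j => iteratedFDeriv ℝ i (f j)) U := by
    intro i _
    obtain ⟨B, hB'⟩ := hB (i + 1)
    exact Literature.Analysis.Calculus.equicontinuousOn_iteratedFDeriv_of_bound hU hf
      (by exact_mod_cast (le_top : ((i + 1 : ℕ) : ℕ∞) ≤ ⊤)) hB'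
  obtain ⟨φ, hφ, hP⟩ := exists_strictMono_forall_tendstoLocallyUniformlyOn_iteratedFDeriv hU
    univ (fun i _ x hx => by
      obtain ⟨B, hB'⟩ := hB i
      exact ⟨B, fun j => hB' j x hx⟩) heq
  obtain ⟨G₀, hG₀⟩ := hP 0 (mem_univ 0)
  have hfg : ∀ x ∈ U, Tendsto (fun j => f (φ j) x) atTop (𝓝 (G₀ x 0)) := fun x hx =>
    tendsto_of_tendstoLocallyUniformlyOn_iteratedFDeriv_zero hG₀ hx
  have hC : ∀ i : ℕ, ∀ x ∈ U, ∃ V ∈ 𝓝 x,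
      UniformCauchySeqOn (fun j => iteratedFDeriv ℝ i (f (φ j))) atTop V := by
    intro i
    obtain ⟨G, hG⟩ := hP i (mem_univ i)
    exact forall_exists_uniformCauchySeqOn_of_tendstoLocallyUniformlyOn hU hG
  obtain ⟨hg, hlim⟩ := contDiffOn_infty_of_uniformCauchySeqOn_iteratedFDeriv hU
    (fun j => hf (φ j)) hfg hC
  exact ⟨fun x => G₀ x 0, φ, hφ, hg, hlim⟩

omit [FiniteDimensional ℝ E] [FiniteDimensional ℝ F] in
/-- **Pointwise consequences** (the form used at a point of a chart): if the derivatives of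
orders `0, 1, 2` of `f_{φ(j)}` converge locally uniformly on `U` to those of `g`, then at every
point of `U` the values, the Fréchet derivatives and the second Fréchet derivatives converge.
[folklore] -/
theorem tendsto_fderiv_of_tendstoLocallyUniformlyOn_iteratedFDeriv {g : E → F} {φ : ℕ → ℕ}
    (hlim : ∀ i ≤ 2, TendstoLocallyUniformlyOn (fun j => iteratedFDeriv ℝ i (f (φ j)))
      (iteratedFDeriv ℝ i g) atTop U) {x : E} (hx : x ∈ U) :
    Tendsto (fun j => f (φ j) x) atTop (𝓝 (g x)) ∧
      Tendsto (fun j => fderiv ℝ (f (φ j)) x) atTop (𝓝 (fderiv ℝ g x)) ∧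
      Tendsto (fun j => fderiv ℝ (fderiv ℝ (f (φ j))) x) atTop
        (𝓝 (fderiv ℝ (fderiv ℝ g) x)) := by
  refine ⟨?_, ?_, ?_⟩
  · simpa only [iteratedFDeriv_zero_apply] using
      tendsto_of_tendstoLocallyUniformlyOn_iteratedFDeriv_zero (hlim 0 (by norm_num)) hx
  · exact tendsto_fderiv_of_tendsto_iteratedFDeriv_one ((hlim 1 (by norm_num)).tendsto_at hx)
  · exact tendsto_fderiv_of_tendsto_iteratedFDeriv_one
      (tendsto_iteratedFDeriv_one_fderiv_of_two ((hlim 2 le_rfl).tendsto_at hx))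

end Extraction

end Literature.Analysis.FunctionSpaces
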